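import Mathlib
import HarnessLib
import Summits.HubbardSuperconductivity.HubbardSuperconductivity.Theorems.KLProgrammeC4aLoopAlignment

/-!
# Route `KLProgramme` — crux C4a, S3 brick (B4)/(B5) «(B4)-ABS-BUBBLE», part 6: the GEOMETRIC ROW in the package's currency — the loop-alignment
# dichotomy of `…C4aLoopAlignment` read contrapositively is the RELATIVE first-order dichotomy `|ē − e| ≤ ε → λ < |∂_φē|` (generic AND Cooper classes)

Cell `gate-hubbard-kl`, seat hubbard-kl-k3c3-p3 (g26; row «implicit-function / monotonicity route for μ(n)»).  Located brick for the (C)-closer lane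
hubbard-kl-c4a-1 (stub (C) `stub_twoLeg_curvature` of `KLRegimeEngineV17F2`, stmt-HubbardSuperconductivity-20437), HOME/hubbard-kl-k3c3-p3/B4-ABS-BUBBLE.md §3
(the table of rows the closer supplies to `…C4aAbsBubbleLevelLoop` / `…C4aAbsBubbleRelative`).

`…C4aLoopAlignment.loopAlignment_dichotomy` (g19): if the partner of the loop point `Φ(e,φ+θ)` is the direct-sheet chart point `Φ(e′,ψ)`, then with the slope
`ℓ = De_K(Φ(e′,ψ))[∂_sΦ(e,φ+θ)] = −∂_φē` and `τ = ((π/2)|ℓ|/((Dt−2A)u_min) + πKc|e′−e|/(Dt−2A)²)/c_K`, EITHER (COOPER) `(2u_min/π)‖ϑ − π‖_𝕋 ≤ msD₁·τ + |e−e′|/(Dt−2A)`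
OR (TANGENCY corner) `‖S − 2Φ(0,φ+θ)‖ ≤ msD₁·τ + (|e|+|e′|)/(Dt−2A)`.  Both right-hand sides are MONOTONE in `(|ℓ|, |e′−e|)`.  Hence
(**`abs_deriv_partnerBand_pp_angle_gt_of_loopAlignment`**): for thresholds `λ`, `ε ≥ |ē − e|`, at a configuration with
`msD₁·τ(λ,ε) + ε/(Dt−2A) < (2u_min/π)‖ϑ − π‖_𝕋` (NOT Cooper at scale `(λ,ε)`) and a loop angle with `msD₁·τ(λ,ε) + (2|e|+ε)/(Dt−2A) < ‖S − 2Φ(0,φ+θ)‖` (loop point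
NOT in the tangency corner), the slope obeys `λ < |∂_φē|` — the RELATIVE FIRST-ORDER DICHOTOMY `|ē − e| ≤ ε → λ < |∂_φē|` of `…C4aAbsBubbleRelative` /
`integral_inv_envelope_le_cooper`, with the generic class (`λ, ε` fixed by `δ_C, δ_T`) and the Cooper class (`λ = ĉ₁η`, `ε = ĉ₀η`, `η = ‖ϑ − π‖_𝕋`: the
hypothesis `hC` is then LINEAR in `η` and holds for `ĉ₀, ĉ₁` small against `2u_min/π`) as the two instances (`…_cooper_scale` spells the latter out).
Pure bookkeeping on landed objects (binder shape = `…C4aLoopAlignment`); nothing about the model's sizes; nothing asserts (C), K3 or superconductivity.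
References: BGM 2003 §7.1 Lemma 7.1 (A1.9) [cite: BenfattoGiulianiMastropietro2003]; FST II CPAM 51 (1998) §3 [cite: FeldmanSalmhoferTrubowitz1998];
Salmhofer 1999 §4.5.3 Lemma 4.10 [cite: Salmhofer1999].
-/

noncomputable section

namespace Summit.HubbardSuperconductivity.HubbardSuperconductivity.Theorems.C4a

set_option linter.dupNamespace false -- summit = problem name (single-conjunct summit), D-0017

open Real Set
open Literature.MathematicalPhysics.QuantumLattice Literature.MathematicalPhysics.QuantumLattice.BandSectorCounting
open Literature.MathematicalPhysics.QuantumLattice.FermiRG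
open Summit.HubbardSuperconductivity.HubbardSuperconductivity.Theorems.KLRegimeSplit
open Summit.HubbardSuperconductivity.HubbardSuperconductivity.Theorems.DispersionFlow
open Summit.HubbardSuperconductivity.HubbardSuperconductivity.Theorems.PerturbedFermiCurve

section Sizes

variable {K : TrigPolyC4v} {A : ℝ} (hA : ∀ p : Momentum, ∀ j ≤ 2, ‖iteratedFDeriv ℝ j (frameShift K) p‖ ≤ A) (hA20 : A ≤ 1 / 20)
  (hd : klCurveD ≤ (bandBounds (show (-4 : ℝ) < -1.1 by norm_num) (show (-1.1 : ℝ) ≤ -0.1 by norm_num)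
    (show (-0.1 : ℝ) < 0 by norm_num)).Dtmin - 2 * A)
  {μ r : ℝ} (hr : 0 < r) (hlo : (-1.1 : ℝ) < μ - r - A) (hhi : μ + r + A < -0.1)
  {A₃ A₄ : ℝ} (hA₃ : ∀ p : Momentum, ‖iteratedFDeriv ℝ 3 (frameShift K) p‖ ≤ A₃)
  (hA₄ : ∀ p : Momentum, ‖iteratedFDeriv ℝ 4 (frameShift K) p‖ ≤ A₄)
include hA hA20 hd hr hlo hhi hA₃ hA₄

/-- **THE RELATIVE FIRST-ORDER DICHOTOMY ROW** (contrapositive of `loopAlignment_dichotomy`).  Under clause (i) of `FrameOK` and `GeomConstants`, let the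
partner of the co-moving pp loop point `Φ(e,φ+θ)` be the direct-sheet chart point `Φ(e′,ψ)` with `|e′ − e| ≤ ε`, and let `λ ∈ ℝ`.  If the configuration is
NOT Cooper at scale `(λ,ε)` — `msD₁·τ(λ,ε) + ε/(Dt−2A) < (2u_min/π)·‖ϑ − π‖_𝕋`, `τ(λ,ε) = ((π/2)λ/((Dt−2A)u_min) + πKcε/(Dt−2A)²)/(u_min·w/(4+2A))` — and the
loop point is NOT in the tangency corner — `msD₁·τ(λ,ε) + (2|e|+ε)/(Dt−2A) < ‖S − 2Φ(0,φ+θ)‖` — then `λ < |∂_φ ē(e,φ;ρ,ϑ,θ)|`.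
[cite: BenfattoGiulianiMastropietro2003, §7.1 Lemma 7.1 (A1.9)] -/
theorem abs_deriv_partnerBand_pp_angle_gt_of_loopAlignment {Kc r₀ g₀ w : ℝ} (hG : GeomConstants (frameLevel μ K) Kc r₀ g₀ w) {ρ e e' : ℝ}
    (hρ : |ρ| < r) (he : |e| < r) (he' : |e'| < r) (he₀ : |e| < r₀) {ϑ θ φ ψ : ℝ}
    (hP : pairSumPath μ K ρ ϑ θ 0 - levelPoint μ K e (φ + θ) = levelPoint μ K e' ψ) {lam eps : ℝ} (heps : |e' - e| ≤ eps)
    (hC : msD A₃ A₄ 1 *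
            ((π / 2 * lam /
                  (((bandBounds (show (-4 : ℝ) < -1.1 by norm_num) (show (-1.1 : ℝ) ≤ -0.1 by norm_num) (show (-0.1 : ℝ) < 0 by norm_num)).Dtmin -
                      2 * A) *
                    (bandBounds (show (-4 : ℝ) < -1.1 by norm_num) (show (-1.1 : ℝ) ≤ -0.1 by norm_num) (show (-0.1 : ℝ) < 0 by norm_num)).umin) +
                π * Kc * eps / ((bandBounds (show (-4 : ℝ) < -1.1 by norm_num) (show (-1.1 : ℝ) ≤ -0.1 by norm_num)
                  (show (-0.1 : ℝ) < 0 by norm_num)).Dtmin - 2 * A) ^ 2) /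
              ((bandBounds (show (-4 : ℝ) < -1.1 by norm_num) (show (-1.1 : ℝ) ≤ -0.1 by norm_num) (show (-0.1 : ℝ) < 0 by norm_num)).umin * w /
                (4 + 2 * A))) +
          eps / ((bandBounds (show (-4 : ℝ) < -1.1 by norm_num) (show (-1.1 : ℝ) ≤ -0.1 by norm_num) (show (-0.1 : ℝ) < 0 by norm_num)).Dtmin - 2 * A) <
        2 * (bandBounds (show (-4 : ℝ) < -1.1 by norm_num) (show (-1.1 : ℝ) ≤ -0.1 by norm_num) (show (-0.1 : ℝ) < 0 by norm_num)).umin / π *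
          torusDist (ϑ - π))
    (hT : msD A₃ A₄ 1 *
            ((π / 2 * lam /
                  (((bandBounds (show (-4 : ℝ) < -1.1 by norm_num) (show (-1.1 : ℝ) ≤ -0.1 by norm_num) (show (-0.1 : ℝ) < 0 by norm_num)).Dtmin -
                      2 * A) *
                    (bandBounds (show (-4 : ℝ) < -1.1 by norm_num) (show (-1.1 : ℝ) ≤ -0.1 by norm_num) (show (-0.1 : ℝ) < 0 by norm_num)).umin) +
                π * Kc * eps / ((bandBounds (show (-4 : ℝ) < -1.1 by norm_num) (show (-1.1 : ℝ) ≤ -0.1 by norm_num)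
                  (show (-0.1 : ℝ) < 0 by norm_num)).Dtmin - 2 * A) ^ 2) /
              ((bandBounds (show (-4 : ℝ) < -1.1 by norm_num) (show (-1.1 : ℝ) ≤ -0.1 by norm_num) (show (-0.1 : ℝ) < 0 by norm_num)).umin * w /
                (4 + 2 * A))) +
          (2 * |e| + eps) / ((bandBounds (show (-4 : ℝ) < -1.1 by norm_num) (show (-1.1 : ℝ) ≤ -0.1 by norm_num) (show (-0.1 : ℝ) < 0 by norm_num)).Dtmin -
            2 * A) <
        ‖pairSumPath μ K ρ ϑ θ 0 - (2 : ℝ) • levelPoint μ K 0 (φ + θ)‖) :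
    lam < |deriv (fun x : ℝ => frameLevel μ K (pairSumPath μ K ρ ϑ θ 0 - levelPoint μ K e (x + θ))) φ| := by
  set B := bandBounds (show (-4 : ℝ) < -1.1 by norm_num) (show (-1.1 : ℝ) ≤ -0.1 by norm_num) (show (-0.1 : ℝ) < 0 by norm_num) with hBdef
  by_contra hcon
  push Not at hcon
  -- the slope `ℓ`
  have hℓ : |fderiv ℝ (frameLevel μ K) (levelPoint μ K e' ψ) (iteratedDeriv 1 (levelPoint μ K e) (φ + θ))| ≤ lam := by
    have h := deriv_partnerBand_pp_angle_eq_neg hA hd hlo hhi he hP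
    rw [h, abs_neg] at hcon
    exact hcon
  -- signs of the constants
  have hA0 : 0 ≤ A := (norm_nonneg _).trans (hA 0 0 (by norm_num))
  have hDt : 0 < B.Dtmin - 2 * A := by have := klCurveD_pos; linarith
  have hu : 0 < B.umin := B.umin_pos
  have hw : 0 < w := hG.wmin_pos
  have hcK : 0 < B.umin * w / (4 + 2 * A) := by positivity
  have hKc : 0 ≤ Kc := le_trans (norm_nonneg _) (hG.norm_iteratedFDeriv_le (0 : Momentum) 0 (by norm_num))
  have hM : 0 ≤ msD A₃ A₄ 1 := (norm_nonneg _).trans (norm_iteratedDeriv_levelPoint_le hA hA20 hd hlo hhi hA₃ hA₄ he le_rfl (by norm_num) 0)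
  -- monotonicity of `τ` in `(|ℓ|, |e′ − e|)`
  have hτ : msD A₃ A₄ 1 *
        ((π / 2 * |fderiv ℝ (frameLevel μ K) (levelPoint μ K e' ψ) (iteratedDeriv 1 (levelPoint μ K e) (φ + θ))| /
              ((B.Dtmin - 2 * A) * B.umin) + π * Kc * |e' - e| / (B.Dtmin - 2 * A) ^ 2) / (B.umin * w / (4 + 2 * A))) ≤
      msD A₃ A₄ 1 * ((π / 2 * lam / ((B.Dtmin - 2 * A) * B.umin) + π * Kc * eps / (B.Dtmin - 2 * A) ^ 2) / (B.umin * w / (4 + 2 * A))) := by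
    refine mul_le_mul_of_nonneg_left (div_le_div_of_nonneg_right (add_le_add ?_ ?_) hcK.le) hM
    · exact div_le_div_of_nonneg_right (mul_le_mul_of_nonneg_left hℓ (by positivity)) (by positivity)
    · exact div_le_div_of_nonneg_right (mul_le_mul_of_nonneg_left heps (by positivity)) (by positivity)
  have hee' : |e - e'| ≤ eps := by rw [abs_sub_comm]; exact heps
  have hsum : |e| + |e'| ≤ 2 * |e| + eps := by
    have h1 : |e'| ≤ |e' - e| + |e| := by
      have := abs_add_le (e' - e) e
      rwa [sub_add_cancel] at this
    linarith
  rcases loopAlignment_dichotomy hA hA20 hd hr hlo hhi hA₃ hA₄ hG hρ he he' he₀ hP with h | h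
  · -- Cooper branch: contradicts `hC`
    have h2 : |e - e'| / (B.Dtmin - 2 * A) ≤ eps / (B.Dtmin - 2 * A) := div_le_div_of_nonneg_right hee' hDt.le
    linarith
  · -- tangency branch: contradicts `hT`
    have h2 : (|e| + |e'|) / (B.Dtmin - 2 * A) ≤ (2 * |e| + eps) / (B.Dtmin - 2 * A) := div_le_div_of_nonneg_right hsum hDt.le
    linarith

/-- **THE COOPER-CLASS INSTANCE.**  Same hypotheses with the scaled thresholds `λ = ĉ₁·η`, `ε = ĉ₀·η`, `η = ‖ϑ − π‖_𝕋 > 0`: the non-Cooper hypothesis becomes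
the `η`-FREE smallness condition `msD₁·τ(ĉ₁,ĉ₀) + ĉ₀/(Dt−2A) < 2u_min/π` on `(ĉ₀, ĉ₁)` (it is linear in `η`), and the conclusion is the scaled dichotomy
`|ē − e| ≤ ĉ₀η → ĉ₁η < |∂_φē|` of `integral_inv_envelope_le_cooper` / `level_loop_inv_envelope_le_cooper`. -/
theorem abs_deriv_partnerBand_pp_angle_gt_cooper_scale {Kc r₀ g₀ w : ℝ} (hG : GeomConstants (frameLevel μ K) Kc r₀ g₀ w) {ρ e e' : ℝ}
    (hρ : |ρ| < r) (he : |e| < r) (he' : |e'| < r) (he₀ : |e| < r₀) {ϑ θ φ ψ : ℝ}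
    (hP : pairSumPath μ K ρ ϑ θ 0 - levelPoint μ K e (φ + θ) = levelPoint μ K e' ψ) {c₀ c₁ : ℝ}
    (hη : 0 < torusDist (ϑ - π)) (heps : |e' - e| ≤ c₀ * torusDist (ϑ - π))
    (hsmall : msD A₃ A₄ 1 *
            ((π / 2 * c₁ /
                  (((bandBounds (show (-4 : ℝ) < -1.1 by norm_num) (show (-1.1 : ℝ) ≤ -0.1 by norm_num) (show (-0.1 : ℝ) < 0 by norm_num)).Dtmin -
                      2 * A) *
                    (bandBounds (show (-4 : ℝ) < -1.1 by norm_num) (show (-1.1 : ℝ) ≤ -0.1 by norm_num) (show (-0.1 : ℝ) < 0 by norm_num)).umin) +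
                π * Kc * c₀ / ((bandBounds (show (-4 : ℝ) < -1.1 by norm_num) (show (-1.1 : ℝ) ≤ -0.1 by norm_num)
                  (show (-0.1 : ℝ) < 0 by norm_num)).Dtmin - 2 * A) ^ 2) /
              ((bandBounds (show (-4 : ℝ) < -1.1 by norm_num) (show (-1.1 : ℝ) ≤ -0.1 by norm_num) (show (-0.1 : ℝ) < 0 by norm_num)).umin * w /
                (4 + 2 * A))) +
          c₀ / ((bandBounds (show (-4 : ℝ) < -1.1 by norm_num) (show (-1.1 : ℝ) ≤ -0.1 by norm_num) (show (-0.1 : ℝ) < 0 by norm_num)).Dtmin - 2 * A) <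
        2 * (bandBounds (show (-4 : ℝ) < -1.1 by norm_num) (show (-1.1 : ℝ) ≤ -0.1 by norm_num) (show (-0.1 : ℝ) < 0 by norm_num)).umin / π)
    (hT : msD A₃ A₄ 1 *
            ((π / 2 * (c₁ * torusDist (ϑ - π)) /
                  (((bandBounds (show (-4 : ℝ) < -1.1 by norm_num) (show (-1.1 : ℝ) ≤ -0.1 by norm_num) (show (-0.1 : ℝ) < 0 by norm_num)).Dtmin -
                      2 * A) *
                    (bandBounds (show (-4 : ℝ) < -1.1 by norm_num) (show (-1.1 : ℝ) ≤ -0.1 by norm_num) (show (-0.1 : ℝ) < 0 by norm_num)).umin) +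
                π * Kc * (c₀ * torusDist (ϑ - π)) / ((bandBounds (show (-4 : ℝ) < -1.1 by norm_num) (show (-1.1 : ℝ) ≤ -0.1 by norm_num)
                  (show (-0.1 : ℝ) < 0 by norm_num)).Dtmin - 2 * A) ^ 2) /
              ((bandBounds (show (-4 : ℝ) < -1.1 by norm_num) (show (-1.1 : ℝ) ≤ -0.1 by norm_num) (show (-0.1 : ℝ) < 0 by norm_num)).umin * w /
                (4 + 2 * A))) +
          (2 * |e| + c₀ * torusDist (ϑ - π)) / ((bandBounds (show (-4 : ℝ) < -1.1 by norm_num) (show (-1.1 : ℝ) ≤ -0.1 by norm_num)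
            (show (-0.1 : ℝ) < 0 by norm_num)).Dtmin - 2 * A) <
        ‖pairSumPath μ K ρ ϑ θ 0 - (2 : ℝ) • levelPoint μ K 0 (φ + θ)‖) :
    c₁ * torusDist (ϑ - π) < |deriv (fun x : ℝ => frameLevel μ K (pairSumPath μ K ρ ϑ θ 0 - levelPoint μ K e (x + θ))) φ| := by
  set B := bandBounds (show (-4 : ℝ) < -1.1 by norm_num) (show (-1.1 : ℝ) ≤ -0.1 by norm_num) (show (-0.1 : ℝ) < 0 by norm_num) with hBdef
  set η := torusDist (ϑ - π) with hηdef
  refine abs_deriv_partnerBand_pp_angle_gt_of_loopAlignment hA hA20 hd hr hlo hhi hA₃ hA₄ hG hρ he he' he₀ hP heps ?_ hT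
  -- the non-Cooper hypothesis at scale `η` is `η ×` the `η`-free smallness condition
  have key : msD A₃ A₄ 1 * ((π / 2 * (c₁ * η) / ((B.Dtmin - 2 * A) * B.umin) + π * Kc * (c₀ * η) / (B.Dtmin - 2 * A) ^ 2) /
        (B.umin * w / (4 + 2 * A))) + c₀ * η / (B.Dtmin - 2 * A) =
      η * (msD A₃ A₄ 1 * ((π / 2 * c₁ / ((B.Dtmin - 2 * A) * B.umin) + π * Kc * c₀ / (B.Dtmin - 2 * A) ^ 2) / (B.umin * w / (4 + 2 * A))) +
        c₀ / (B.Dtmin - 2 * A)) := by ring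
  rw [key, show 2 * B.umin / π * η = η * (2 * B.umin / π) by ring]
  exact mul_lt_mul_of_pos_left hsmall hη

end Sizes

end Summit.HubbardSuperconductivity.HubbardSuperconductivity.Theorems.C4a

end
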